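import Mathlib
import Summits.PneNP.PneNP.Theorems.OverlapGapAlgebraNoStableSectionDefs

/-!
# Route OverlapGapAlgebra, crux `NoStableSection` (stmt-PneNP-2462), line `DartGame`: entropy

Stub `stub_entropyToolkit` (the body of `EntropyToolkit`) of the skeleton
`Summits/PneNP/PneNP/Cruxes/NoStableSection/Lines/DartGame.lean`: Bresler–Huang
(FOCS 2021 / arXiv:2106.02129) Fact 4.5(iii) and Lemma 4.8, for the ORDERED conditional type
entropy `condEnt (withRung R ℓ v) ℓ` of a candidate `v : Fin n → Bool` given the rungs
`R 0, …, R (ℓ-1)` (the potential of the ladder extraction):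
1. `condEnt_withRung_eq_zero_of_mem`: the potential vanishes on a repeated rung;
2. `abs_condEnt_withRung_sub_le_binEntropy`: it is `h₂(Δ/n)`-continuous in the candidate,
   `|condEnt(v) - condEnt(v')| ≤ h₂(Δ(v,v')/n)` for Hamming distance `Δ(v,v') ≤ n/2`
   (`h₂ = Real.binEntropy`, nats).
Proof: by the conditional form `condEnt_eq_sum_binEntropy`,
`condEnt (withRung R ℓ v) ℓ = Σ_ξ (N_ξ/n) h₂(A_ξ(v)/N_ξ)` where `N_ξ` counts the positions whose
column over the prefix is `ξ` and `A_ξ(v)` those among them where `v` is `true`. (1): on a repeated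
rung `A_ξ ∈ {0, N_ξ}`. (2): `|h₂ a - h₂ b| ≤ h₂ |a - b|` on `[0,1]` (subadditivity of the concave
`h₂`, `h₂ 0 = 0`, and the symmetry `h₂ (1 - x) = h₂ x`), Jensen's inequality for `h₂` with the
weights `N_ξ/n`, `Σ_ξ |A_ξ(v) - A_ξ(v')| ≤ Δ(v,v')` (the classes partition the disagreement set),
and monotonicity of `h₂` on `[0, 1/2]`.
-/

namespace Summit.PneNP.PneNP.Cruxes.NoStableSection.DartGame

set_option linter.dupNamespace false -- `Summit.PneNP.PneNP.…`: summit = sub-problem (D-0017)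

/-! ## Stub B — the entropy toolkit (BH Fact 4.5(iii) and Lemma 4.8) -/

section EntropyToolkit

open Finset Real

variable {n : ℕ}

/-! ### Scalar facts about the binary entropy `h₂ = Real.binEntropy` -/

/-- Subadditivity of the binary entropy on `[0,1]`: `h₂ (x + y) ≤ h₂ x + h₂ y` for `x, y ≥ 0` with
`x + y ≤ 1` (concavity of `h₂` on `[0,1]`, Mathlib's `Real.strictConcave_binEntropy`, and
`h₂ 0 = 0`). -/
theorem ent_binEntropy_add_le {x y : ℝ} (hx : 0 ≤ x) (hy : 0 ≤ y) (hxy : x + y ≤ 1) :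
    binEntropy (x + y) ≤ binEntropy x + binEntropy y := by
  rcases (add_nonneg hx hy).eq_or_lt with h0 | hpos
  · have hx0 : x = 0 := by linarith
    have hy0 : y = 0 := by linarith
    simp [hx0, hy0]
  · have hc := strictConcave_binEntropy.concaveOn
    have hs : x + y ∈ Set.Icc (0 : ℝ) 1 := ⟨hpos.le, hxy⟩
    have h0 : (0 : ℝ) ∈ Set.Icc (0 : ℝ) 1 := ⟨le_rfl, zero_le_one⟩
    have hne : x + y ≠ 0 := hpos.ne'
    have hab : x / (x + y) + y / (x + y) = 1 := by rw [← add_div, div_self hne]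
    have h1 := hc.2 hs h0 (div_nonneg hx hpos.le) (div_nonneg hy hpos.le) hab
    have h2 := hc.2 hs h0 (div_nonneg hy hpos.le) (div_nonneg hx hpos.le)
      ((add_comm _ _).trans hab)
    simp only [smul_eq_mul, mul_zero, add_zero, binEntropy_zero, div_mul_cancel₀ _ hne] at h1 h2
    -- `h1 : x/(x+y) · h₂(x+y) ≤ h₂ x`, `h2 : y/(x+y) · h₂(x+y) ≤ h₂ y`
    calc binEntropy (x + y)
        = x / (x + y) * binEntropy (x + y) + y / (x + y) * binEntropy (x + y) := by
          rw [← add_mul, hab, one_mul]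
      _ ≤ binEntropy x + binEntropy y := add_le_add h1 h2

/-- `h₂` is `h₂`-continuous on `[0,1]`: `|h₂ a - h₂ b| ≤ h₂ |a - b|` (the scalar inequality behind
BH Lemma 4.8; from subadditivity and the symmetry `h₂ (1 - x) = h₂ x`). -/
theorem ent_abs_binEntropy_sub_le {a b : ℝ} (ha : a ∈ Set.Icc (0 : ℝ) 1)
    (hb : b ∈ Set.Icc (0 : ℝ) 1) : |binEntropy a - binEntropy b| ≤ binEntropy |a - b| := by
  -- it suffices to treat ordered pairs
  suffices key : ∀ a b : ℝ, a ∈ Set.Icc (0 : ℝ) 1 → b ∈ Set.Icc (0 : ℝ) 1 → b ≤ a →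
      |binEntropy a - binEntropy b| ≤ binEntropy (a - b) by
    rcases le_total b a with h | h
    · rw [abs_of_nonneg (sub_nonneg.2 h)]
      exact key a b ha hb h
    · rw [abs_sub_comm (binEntropy a), abs_sub_comm a b, abs_of_nonneg (sub_nonneg.2 h)]
      exact key b a hb ha h
  intro a b ha hb hle
  rw [abs_sub_le_iff]
  constructor
  · -- `h₂ a = h₂ (b + (a - b)) ≤ h₂ b + h₂ (a - b)`
    have := ent_binEntropy_add_le hb.1 (sub_nonneg.2 hle) (by linarith [ha.2])
    rw [show b + (a - b) = a by ring] at this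
    linarith
  · -- `h₂ b = h₂ (1 - b) = h₂ ((1 - a) + (a - b)) ≤ h₂ (1 - a) + h₂ (a - b) = h₂ a + h₂ (a - b)`
    have := ent_binEntropy_add_le (sub_nonneg.2 ha.2) (sub_nonneg.2 hle) (by linarith [hb.1])
    rw [show 1 - a + (a - b) = 1 - b by ring, binEntropy_one_sub, binEntropy_one_sub] at this
    linarith

/-- Abstract form of BH Lemma 4.8: two mixtures of binary entropies with the same weights differ by
at most `h₂ μ` whenever the weighted mean deviation of their arguments is `≤ μ ≤ 1/2` (triangle
inequality, `ent_abs_binEntropy_sub_le`, Jensen's inequality for the concave `h₂`, and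
monotonicity of `h₂` on `[0, 1/2]`). -/
theorem ent_abs_sum_sub_sum_le {ι : Type*} {s : Finset ι} {w a a' : ι → ℝ} {μ : ℝ}
    (hw0 : ∀ i ∈ s, 0 ≤ w i) (hw1 : ∑ i ∈ s, w i = 1)
    (ha : ∀ i ∈ s, a i ∈ Set.Icc (0 : ℝ) 1) (ha' : ∀ i ∈ s, a' i ∈ Set.Icc (0 : ℝ) 1)
    (hμ : ∑ i ∈ s, w i * |a i - a' i| ≤ μ) (hμ2 : μ ≤ 2⁻¹) :
    |∑ i ∈ s, w i * binEntropy (a i) - ∑ i ∈ s, w i * binEntropy (a' i)| ≤ binEntropy μ := by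
  have hp : ∀ i ∈ s, |a i - a' i| ∈ Set.Icc (0 : ℝ) 1 := fun i hi =>
    ⟨abs_nonneg _, abs_sub_le_iff.2
      ⟨by linarith [(ha i hi).2, (ha' i hi).1], by linarith [(ha i hi).1, (ha' i hi).2]⟩⟩
  have hs0 : 0 ≤ ∑ i ∈ s, w i * |a i - a' i| :=
    sum_nonneg fun i hi => mul_nonneg (hw0 i hi) (abs_nonneg _)
  have hJ := strictConcave_binEntropy.concaveOn.le_map_sum hw0 hw1 hp
  simp only [smul_eq_mul] at hJ
  calc |∑ i ∈ s, w i * binEntropy (a i) - ∑ i ∈ s, w i * binEntropy (a' i)|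
      = |∑ i ∈ s, w i * (binEntropy (a i) - binEntropy (a' i))| := by
        rw [← sum_sub_distrib]
        simp only [mul_sub]
    _ ≤ ∑ i ∈ s, |w i * (binEntropy (a i) - binEntropy (a' i))| := abs_sum_le_sum_abs _ _
    _ = ∑ i ∈ s, w i * |binEntropy (a i) - binEntropy (a' i)| :=
        sum_congr rfl fun i hi => by rw [abs_mul, abs_of_nonneg (hw0 i hi)]
    _ ≤ ∑ i ∈ s, w i * binEntropy |a i - a' i| :=
        sum_le_sum fun i hi =>
          mul_le_mul_of_nonneg_left (ent_abs_binEntropy_sub_le (ha i hi) (ha' i hi)) (hw0 i hi)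
    _ ≤ binEntropy (∑ i ∈ s, w i * |a i - a' i|) := hJ
    _ ≤ binEntropy μ :=
        binEntropy_strictMonoOn.monotoneOn ⟨hs0, hμ.trans hμ2⟩ ⟨hs0.trans hμ, hμ2⟩ hμ

/-- A ratio of counts `A ≤ N` lies in `[0,1]` (also when `N = 0`, by `x / 0 = 0`). -/
theorem ent_div_mem_Icc {A N : ℕ} (h : A ≤ N) : (A : ℝ) / N ∈ Set.Icc (0 : ℝ) 1 :=
  ⟨by positivity, div_le_one_of_le₀ (by exact_mod_cast h) (Nat.cast_nonneg N)⟩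

/-- Per-class step of BH Lemma 4.8: `(N/m) · |A/N - A'/N| ≤ |A - A'| / m` (an equality unless
`N = 0`). -/
theorem ent_weight_mul_abs_sub_le {m N : ℝ} (hm : 0 < m) (hN : 0 ≤ N) (A A' : ℝ) :
    N / m * |A / N - A' / N| ≤ |A - A'| / m := by
  rcases hN.eq_or_lt with h0 | hpos
  · rw [← h0, zero_div, zero_mul]
    exact div_nonneg (abs_nonneg _) hm.le
  · rw [← sub_div, abs_div, abs_of_pos hpos]
    apply le_of_eq
    rw [div_mul_div_comm, mul_comm N, mul_div_mul_right _ _ hpos.ne']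

/-! ### Pattern classes of `withRung R ℓ v` -/

/-- Below the inserted rung the pattern classes of `withRung R ℓ v` are those of the prefix `R`. -/
theorem ent_patCount_withRung (R : ℕ → Fin n → Bool) (ℓ : ℕ) (v : Fin n → Bool)
    (ξ : Fin ℓ → Bool) : patCount (withRung R ℓ v) ℓ ξ = patCount R ℓ ξ :=
  patCount_congr (fun _ hj => withRung_of_lt R ℓ v hj) ξ

/-- A position has column `ξ·b` over the first `ℓ + 1` rungs of `withRung R ℓ v` iff its column over
the prefix is `ξ` and `v` gives it the value `b`. -/
theorem ent_col_withRung_eq_snoc_iff (R : ℕ → Fin n → Bool) (ℓ : ℕ) (v : Fin n → Bool)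
    (ξ : Fin ℓ → Bool) (b : Bool) (i : Fin n) :
    ((fun j : Fin (ℓ + 1) => withRung R ℓ v j i) = Fin.snoc ξ b) ↔
      ((fun j : Fin ℓ => R j i) = ξ ∧ v i = b) := by
  constructor
  · intro h
    refine ⟨funext fun j => ?_, ?_⟩
    · simpa [withRung_of_lt R ℓ v j.isLt] using congrFun h (Fin.castSucc j)
    · simpa using congrFun h (Fin.last ℓ)
  · rintro ⟨h1, h2⟩
    funext j
    refine Fin.lastCases ?_ (fun j => ?_) j
    · simpa using h2
    · simpa [withRung_of_lt R ℓ v j.isLt] using congrFun h1 j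

/-- The refined class counts of `withRung R ℓ v`: positions with prefix column `ξ` and `v i = b`. -/
theorem ent_patCount_withRung_succ (R : ℕ → Fin n → Bool) (ℓ : ℕ) (v : Fin n → Bool)
    (ξ : Fin ℓ → Bool) (b : Bool) :
    patCount (withRung R ℓ v) (ℓ + 1) (Fin.snoc ξ b) =
      #(univ.filter fun i : Fin n => (fun j : Fin ℓ => R j i) = ξ ∧ v i = b) := by
  unfold patCount
  congr 1
  ext i
  simp only [mem_filter, mem_univ, true_and, ent_col_withRung_eq_snoc_iff]

/-- The refined class is contained in the class: `N_{ℓ+1}(ξ·true) ≤ N_ℓ(ξ)`. -/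
theorem ent_patCount_snoc_le (R : ℕ → Fin n → Bool) (ℓ : ℕ) (v : Fin n → Bool)
    (ξ : Fin ℓ → Bool) : patCount (withRung R ℓ v) (ℓ + 1) (Fin.snoc ξ true) ≤ patCount R ℓ ξ := by
  rw [← ent_patCount_withRung R ℓ v ξ, patCount_succ_eq (withRung R ℓ v) ℓ ξ]
  exact Nat.le_add_right _ _

/-- One-sided count comparison: the positions of a class where `v` is `true` are among those where
`v` and `v'` disagree or `v'` is `true`. -/
theorem ent_card_filter_and_le {α : Type*} [DecidableEq α] (s : Finset α) (p : α → Prop)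
    [DecidablePred p] (v v' : α → Bool) :
    #(s.filter fun i => p i ∧ v i = true) ≤
      #(s.filter fun i => p i ∧ v i ≠ v' i) + #(s.filter fun i => p i ∧ v' i = true) := by
  calc #(s.filter fun i => p i ∧ v i = true)
      ≤ #((s.filter fun i => p i ∧ v i ≠ v' i) ∪ (s.filter fun i => p i ∧ v' i = true)) := by
        refine card_le_card fun i => ?_
        simp only [mem_filter, mem_union]
        rintro ⟨hs, hp, hv⟩
        by_cases h' : v' i = true
        · exact Or.inr ⟨hs, hp, h'⟩
        · exact Or.inl ⟨hs, hp, fun h => h' (by rw [← h]; exact hv)⟩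
    _ ≤ _ := card_union_le _ _

/-- Class by class, the refined counts of two candidates differ by at most the number of
disagreements of the candidates inside the class. -/
theorem ent_abs_patCount_sub_le (R : ℕ → Fin n → Bool) (ℓ : ℕ) (v v' : Fin n → Bool)
    (ξ : Fin ℓ → Bool) :
    |(patCount (withRung R ℓ v) (ℓ + 1) (Fin.snoc ξ true) : ℝ) -
        patCount (withRung R ℓ v') (ℓ + 1) (Fin.snoc ξ true)| ≤
      #(univ.filter fun i : Fin n => (fun j : Fin ℓ => R j i) = ξ ∧ v i ≠ v' i) := by
  rw [ent_patCount_withRung_succ, ent_patCount_withRung_succ]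
  have h1 := ent_card_filter_and_le univ (fun i : Fin n => (fun j : Fin ℓ => R j i) = ξ) v v'
  have h2 := ent_card_filter_and_le univ (fun i : Fin n => (fun j : Fin ℓ => R j i) = ξ) v' v
  have h3 : #(univ.filter fun i : Fin n => (fun j : Fin ℓ => R j i) = ξ ∧ v' i ≠ v i) =
      #(univ.filter fun i : Fin n => (fun j : Fin ℓ => R j i) = ξ ∧ v i ≠ v' i) := by
    congr 1
    exact filter_congr fun i _ => by rw [ne_comm]
  rw [h3] at h2
  rw [abs_sub_le_iff]
  constructor
  · have := (Nat.cast_le (α := ℝ)).2 h1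
    push_cast at this
    linarith
  · have := (Nat.cast_le (α := ℝ)).2 h2
    push_cast at this
    linarith

/-- The classes partition the disagreement set: `Σ_ξ #{i ∈ class ξ : v i ≠ v' i} = Δ(v, v')`. -/
theorem ent_sum_card_disagree (R : ℕ → Fin n → Bool) (ℓ : ℕ) (v v' : Fin n → Bool) :
    ∑ ξ : Fin ℓ → Bool, #(univ.filter fun i : Fin n => (fun j : Fin ℓ => R j i) = ξ ∧ v i ≠ v' i) =
      hammingDist v v' := by
  unfold hammingDist
  rw [card_eq_sum_card_fiberwise (f := fun i : Fin n => fun j : Fin ℓ => R j i) (t := univ)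
    fun i _ => mem_univ _]
  refine sum_congr rfl fun ξ _ => ?_
  congr 1
  ext i
  simp only [mem_filter, mem_univ, true_and]
  exact ⟨fun h => ⟨h.2, h.1⟩, fun h => ⟨h.2, h.1⟩⟩

/-! ### The two conjuncts -/

/-- **BH Fact 4.5(iii)** (ordered form): the conditional type entropy of a candidate that repeats
an earlier rung vanishes, `condEnt (withRung R ℓ (R j₀)) ℓ = 0` for `j₀ < ℓ` (every refined class
is the whole class or empty). -/
theorem condEnt_withRung_eq_zero_of_mem (n ℓ : ℕ) (R : ℕ → Fin n → Bool) (v : Fin n → Bool)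
    (hv : ∃ j < ℓ, R j = v) : condEnt (withRung R ℓ v) ℓ = 0 := by
  obtain ⟨j₀, hj₀, rfl⟩ := hv
  rw [condEnt_eq_sum_binEntropy]
  refine sum_eq_zero fun ξ _ => ?_
  rw [ent_patCount_withRung, ent_patCount_withRung_succ]
  cases hξ : ξ ⟨j₀, hj₀⟩
  · -- `ξ j₀ = false`: no position of the class has `R j₀ i = true`
    have h0 : (univ.filter fun i : Fin n => (fun j : Fin ℓ => R j i) = ξ ∧ R j₀ i = true) = ∅ := by
      refine filter_eq_empty_iff.2 fun i _ h => ?_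
      have h1 := congrFun h.1 ⟨j₀, hj₀⟩
      simp [hξ, h.2] at h1
    rw [h0, card_empty, Nat.cast_zero, zero_div, binEntropy_zero, mul_zero]
  · -- `ξ j₀ = true`: the refined class is the whole class
    have h0 : (univ.filter fun i : Fin n => (fun j : Fin ℓ => R j i) = ξ ∧ R j₀ i = true) =
        univ.filter fun i : Fin n => (fun j : Fin ℓ => R j i) = ξ := by
      refine filter_congr fun i _ => ⟨fun h => h.1, fun h => ⟨h, ?_⟩⟩
      simpa [hξ] using congrFun h ⟨j₀, hj₀⟩
    have h2 : #(univ.filter fun i : Fin n => (fun j : Fin ℓ => R j i) = ξ) = patCount R ℓ ξ := rfl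
    rw [h0, h2]
    rcases Nat.eq_zero_or_pos (patCount R ℓ ξ) with hN | hN
    · rw [hN, Nat.cast_zero, zero_div, zero_mul]
    · rw [div_self (Nat.cast_ne_zero.2 hN.ne'), binEntropy_one, mul_zero]

/-- **BH Lemma 4.8** (ordered form): the conditional type entropy is `h₂(Δ/n)`-continuous in the
candidate, `|condEnt (withRung R ℓ v) ℓ - condEnt (withRung R ℓ v') ℓ| ≤ h₂ (Δ(v,v') / n)`
whenever the Hamming distance `Δ(v,v')` is at most `n / 2`. -/
theorem abs_condEnt_withRung_sub_le_binEntropy (n ℓ : ℕ) (R : ℕ → Fin n → Bool)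
    (v v' : Fin n → Bool) (hd : (hammingDist v v' : ℝ) ≤ n / 2) :
    |condEnt (withRung R ℓ v) ℓ - condEnt (withRung R ℓ v') ℓ| ≤
      binEntropy ((hammingDist v v' : ℝ) / n) := by
  rcases Nat.eq_zero_or_pos n with rfl | hn
  · -- no positions: both candidates coincide
    have h : v = v' := funext fun i => i.elim0
    subst h
    simp
  have hnr : (0 : ℝ) < n := by exact_mod_cast hn
  rw [condEnt_eq_sum_binEntropy, condEnt_eq_sum_binEntropy]
  simp only [ent_patCount_withRung]
  refine ent_abs_sum_sub_sum_le (fun ξ _ => by positivity) ?_ (fun ξ _ => ?_) (fun ξ _ => ?_)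
    ?_ ?_
  · -- the weights `N_ξ / n` sum to one
    rw [← sum_div, div_eq_one_iff_eq hnr.ne']
    exact_mod_cast sum_patCount R ℓ
  · exact ent_div_mem_Icc (ent_patCount_snoc_le R ℓ v ξ)
  · exact ent_div_mem_Icc (ent_patCount_snoc_le R ℓ v' ξ)
  · -- the weighted mean deviation is at most `Δ / n`
    calc ∑ ξ : Fin ℓ → Bool, (patCount R ℓ ξ : ℝ) / n *
          |(patCount (withRung R ℓ v) (ℓ + 1) (Fin.snoc ξ true) : ℝ) / patCount R ℓ ξ -
            (patCount (withRung R ℓ v') (ℓ + 1) (Fin.snoc ξ true) : ℝ) / patCount R ℓ ξ|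
        ≤ ∑ ξ : Fin ℓ → Bool, |(patCount (withRung R ℓ v) (ℓ + 1) (Fin.snoc ξ true) : ℝ) -
            patCount (withRung R ℓ v') (ℓ + 1) (Fin.snoc ξ true)| / n :=
          sum_le_sum fun ξ _ => ent_weight_mul_abs_sub_le hnr (Nat.cast_nonneg _) _ _
      _ ≤ ∑ ξ : Fin ℓ → Bool,
            (#(univ.filter fun i : Fin n => (fun j : Fin ℓ => R j i) = ξ ∧ v i ≠ v' i) : ℝ) / n :=
          sum_le_sum fun ξ _ =>
            div_le_div_of_nonneg_right (ent_abs_patCount_sub_le R ℓ v v' ξ) hnr.le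
      _ = (hammingDist v v' : ℝ) / n := by
          rw [← sum_div, ← ent_sum_card_disagree R ℓ v v', Nat.cast_sum]
  · -- `Δ / n ≤ 1/2`
    rw [div_le_iff₀ hnr]
    linarith

/-- **Stub B `stub_entropyToolkit`** of line `DartGame` (the body of `EntropyToolkit` in the
skeleton, declared under the registered stub name):
(1) the ladder potential `v ↦ condEnt (withRung R ℓ v) ℓ` vanishes on the earlier rungs, and
(2) it is `h₂(Δ/n)`-continuous in the candidate for Hamming distance `Δ ≤ n/2`
(Bresler–Huang, arXiv:2106.02129, Fact 4.5(iii) and Lemma 4.8, ordered conditional form). -/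
theorem stub_entropyToolkit :
    (∀ (n ℓ : ℕ) (R : ℕ → Fin n → Bool) (v : Fin n → Bool),
        (∃ j < ℓ, R j = v) → condEnt (withRung R ℓ v) ℓ = 0) ∧
    (∀ (n ℓ : ℕ) (R : ℕ → Fin n → Bool) (v v' : Fin n → Bool),
        (hammingDist v v' : ℝ) ≤ n / 2 →
        |condEnt (withRung R ℓ v) ℓ - condEnt (withRung R ℓ v') ℓ| ≤
          Real.binEntropy ((hammingDist v v' : ℝ) / n)) :=
  ⟨condEnt_withRung_eq_zero_of_mem, abs_condEnt_withRung_sub_le_binEntropy⟩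

end EntropyToolkit

end Summit.PneNP.PneNP.Cruxes.NoStableSection.DartGame
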